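import Mathlib.Data.ZMod.Basic
import Mathlib.Data.Int.Interval
import Mathlib.Data.Finset.Prod
import Mathlib.Tactic.Ring
import Mathlib.Tactic.Linarith
import Mathlib.Tactic.NormNum
import HarnessLib

/-!
# Venture HSemireg — THEOREM 44.4's counting inputs (ENGINE-W SEC44 §5, the genus-Z count): the quaternary form
# `Q₁ = 3x² + 6y² + 8(u² − uv + v²)` — its first nineteen representation numbers `1, 0, 0, 2, 0, 0, 2, 0, 6, 4, 0, 12, 2, 0, 12, 0, 0, 24, 4`
# and `r_{Q₁}(41) = 48`, on a provably complete box, with `r_{Q₁}(p) = (4(p−1) − 4y_p)∕3` at `p = 11, 17, 41` — plus the 3-adic step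
# «α ≡ 0 (3) ⇒ 3 ∣ N(c′) ⇒ √−3 ∣ c′» — kernel counts and residues

HONEST FRAMING. Lean index of the computation cell `pub-hsemireg`, widening group ENGINE-W (code A, seat `engine-w-1`, gen 18).
FINITE COUNTS AND RESIDUE ARITHMETIC ONLY; no quaternion order, theta series, Eisenstein series, modular form, abelian variety, sheaf or
semiregularity map is constructed, and THEOREM 44.4 (b) (the identity `θ_{Q₁} = ℰ₁ + ⅔ f_im` in `M₂(Γ₀(24), χ₂₄)`) is NOT formalised; nothing
here says that HC, HC_CM or HC_AV holds. Theorems only (0 `def`, 0 named fact, 0 `sorry`). New namespace `Theta44`. Companion: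
`TwistedThetaCounts.lean` (SEC40: `Q_S`, `Q_E`, `κ_p`; the values `y_11 = 1`, `y_17 = −2`, `y_41 = 4` used below are its `(r_S − r_E)∕4`).

SOURCE (the cell's own result, by value): `widen/ENGINE-W/out/probe5/SEC44-GENUS3-A.md` §5 THEOREM 44.4 («Λ^Z_S … with nrd = 9(x²+2y²) +
24N(c″) = 3·Q₁, Q₁ := 3x² + 6y² + 8(n₁² − n₁n₂ + n₂²) … (a) for every w ∈ Λ′_S with 3 ∥ nrd w: α ≡ 0 (3) ⇒ √−3 ∣ c′ automatically (8N(c′) ≡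
3m mod 9 ⇒ 3 ∣ N(c′)) …; (b) … first coefficients 1, 0, 0, 2, 0, 0, 2, 0, 6, 4, 0, 12, 2, 0, 12, 0, 0, 24, 4, …; (c) … at m = p inert-type:
r_{Q₁}(p) = (4(p−1) − 4y_p)∕3»). What the kernel holds:

* §1 **the 3-adic step**: `three_dvd_normc` (`3 ∣ x`, `3 ∣ y`, `x² + 2y² + 8N = 3m` with `3 ∤ m`… precisely: `9 ∣ x² + 2y²` and
  `x² + 2y² + 8N = 3m` ⟹ `3 ∣ N`), `eisenstein_norm_mod_three` (`u² − uv + v² ≡ (u+v)² (mod 3)`: in `ZMod 3`, `N(c′) = 0 ↔ u + v = 0`, i.e.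
  `3 ∣ N(c′) ⟺ (1−ω) ∣ c′` under `ω ↦ 1`), `nine_dvd_of_three_dvd` (`3 ∣ x`, `3 ∣ y` ⟹ `9 ∣ x² + 2y²`).
* §2 **representation numbers of `Q₁`** by `decide +kernel` on the box `|x| ≤ 4`, `|y| ≤ 2`, `|u|, |v| ≤ 2`, complete for `n ≤ 48` (`box_Q1`):
  `rQ1_first` (the nineteen values `n = 0 … 18` as printed) and `rQ1_41 = 48`; `rQ1_formula` (`(4(p−1) − 4y_p)∕3` at `p = 11, 17, 41` with
  `y = 1, −2, 4` gives `12, 24, 48`).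
-/

namespace Summit.Ventures.HSemireg.Theta44

/-! ## §1 The 3-adic step of THEOREM 44.4 (a) -/

/-- `3 ∣ x` and `3 ∣ y` ⟹ `9 ∣ x² + 2y²`. [kernel] -/
theorem nine_dvd_of_three_dvd {x y : ℤ} (hx : 3 ∣ x) (hy : 3 ∣ y) : 9 ∣ x ^ 2 + 2 * y ^ 2 := by
  obtain ⟨a, rfl⟩ := hx
  obtain ⟨b, rfl⟩ := hy
  exact ⟨a ^ 2 + 2 * b ^ 2, by ring⟩

/-- **«8N(c′) ≡ 3m (mod 9) ⇒ 3 ∣ N(c′)»**: if `9 ∣ x² + 2y²` and `x² + 2y² + 8·N = 3·m`, then `3 ∣ N`. [kernel, `omega`] -/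
theorem three_dvd_normc {x y N m : ℤ} (h9 : 9 ∣ x ^ 2 + 2 * y ^ 2) (h : x ^ 2 + 2 * y ^ 2 + 8 * N = 3 * m) : 3 ∣ N := by
  obtain ⟨k, hk⟩ := h9
  have : 8 * N = 3 * m - 9 * k := by linarith
  omega

/-- **`3 ∣ N(c′) ⟺ √−3 ∣ c′`** at the level of residues: in `ZMod 3`, `u² − uv + v² = 0 ↔ u + v = 0` (the norm form is `(u+v)²` mod 3, and
`ℤ[ω]∕(1−ω) ≅ 𝔽₃` via `ω ↦ 1` sends `u + vω ↦ u + v`). [kernel, `decide`] -/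
theorem eisenstein_norm_mod_three : ∀ u v : ZMod 3, u ^ 2 - u * v + v ^ 2 = 0 ↔ u + v = 0 := by
  decide

/-- The same over `ℤ`: `3 ∣ u² − uv + v² ⟺ 3 ∣ u + v`. [kernel] -/
theorem three_dvd_norm_iff (u v : ℤ) : (3 : ℤ) ∣ u ^ 2 - u * v + v ^ 2 ↔ (3 : ℤ) ∣ u + v := by
  have key := eisenstein_norm_mod_three (u : ZMod 3) (v : ZMod 3)
  have h1 := ZMod.intCast_zmod_eq_zero_iff_dvd (u ^ 2 - u * v + v ^ 2) 3
  have h2 := ZMod.intCast_zmod_eq_zero_iff_dvd (u + v) 3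
  push_cast at h1 h2
  rw [← h1, ← h2]
  exact key

/-! ## §2 Representation numbers of `Q₁ = 3x² + 6y² + 8(u² − uv + v²)` -/

/-- **Completeness of the box**: `Q₁(x,y,u,v) = n ≤ 48` forces `|x| ≤ 4`, `|y| ≤ 2`, `|u|, |v| ≤ 2`. [kernel] -/
theorem box_Q1 (x y u v n : ℤ) (hn : n ≤ 48) (h : 3 * x ^ 2 + 6 * y ^ 2 + 8 * (u ^ 2 - u * v + v ^ 2) = n) :
    (-4 ≤ x ∧ x ≤ 4) ∧ (-2 ≤ y ∧ y ≤ 2) ∧ (-2 ≤ u ∧ u ≤ 2) ∧ (-2 ≤ v ∧ v ≤ 2) := by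
  have hN : 0 ≤ u ^ 2 - u * v + v ^ 2 := by nlinarith [sq_nonneg (2 * u - v), sq_nonneg v]
  have hx : 3 * x ^ 2 ≤ 48 := by nlinarith [sq_nonneg y]
  have hy : 6 * y ^ 2 ≤ 48 := by nlinarith [sq_nonneg x]
  have huv : 8 * (u ^ 2 - u * v + v ^ 2) ≤ 48 := by nlinarith [sq_nonneg x, sq_nonneg y]
  have hv : 6 * v ^ 2 ≤ 48 := by nlinarith [sq_nonneg (2 * u - v)]
  have hu : 6 * u ^ 2 ≤ 48 := by nlinarith [sq_nonneg (2 * v - u)]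
  refine ⟨⟨?_, ?_⟩, ⟨?_, ?_⟩, ⟨?_, ?_⟩, ⟨?_, ?_⟩⟩ <;> nlinarith

/-- **The first nineteen coefficients of `θ_{Q₁}`** (`n = 0 … 18`): `1, 0, 0, 2, 0, 0, 2, 0, 6, 4, 0, 12, 2, 0, 12, 0, 0, 24, 4` — as the list of
counts over the complete box. [kernel, `decide +kernel`] -/
theorem rQ1_first :
    (List.range 19).map (fun n => ((Finset.Icc (-4 : ℤ) 4 ×ˢ Finset.Icc (-2 : ℤ) 2 ×ˢ Finset.Icc (-2 : ℤ) 2 ×ˢ Finset.Icc (-2 : ℤ) 2).filter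
      (fun q => 3 * q.1 ^ 2 + 6 * q.2.1 ^ 2 + 8 * (q.2.2.1 ^ 2 - q.2.2.1 * q.2.2.2 + q.2.2.2 ^ 2) = (n : ℤ))).card)
      = [1, 0, 0, 2, 0, 0, 2, 0, 6, 4, 0, 12, 2, 0, 12, 0, 0, 24, 4] := by
  decide +kernel

/-- **`r_{Q₁}(41) = 48`**. [kernel, `decide +kernel`] -/
theorem rQ1_41 : ((Finset.Icc (-4 : ℤ) 4 ×ˢ Finset.Icc (-2 : ℤ) 2 ×ˢ Finset.Icc (-2 : ℤ) 2 ×ˢ Finset.Icc (-2 : ℤ) 2).filter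
    (fun q => 3 * q.1 ^ 2 + 6 * q.2.1 ^ 2 + 8 * (q.2.2.1 ^ 2 - q.2.2.1 * q.2.2.2 + q.2.2.2 ^ 2) = 41)).card = 48 := by
  decide +kernel

/-- **`r_{Q₁}(p) = (4(p−1) − 4y_p)∕3`** at `p = 11, 17, 41` with `y_p = 1, −2, 4` (SEC40's `(r_{Q_S} − r_{Q_E})∕4`): `12, 24, 48`, matching
`rQ1_first` at `n = 11, 17` and `rQ1_41`. [kernel, `norm_num`] -/
theorem rQ1_formula :
    (4 * (11 - 1) - 4 * 1 : ℤ) = 3 * 12 ∧ (4 * (17 - 1) - 4 * (-2) : ℤ) = 3 * 24 ∧ (4 * (41 - 1) - 4 * 4 : ℤ) = 3 * 48 := by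
  norm_num

end Summit.Ventures.HSemireg.Theta44
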